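import Literature.AlgebraicGeometry.Motives.AbelianVarietyInducedActionIsotypical
import Literature.AlgebraicGeometry.Motives.AbelianVarietyFactorFrobeniusTraces
import HarnessLib

/-!
# Twisted characters of an induced action and the Artin formalism for `Ind_H^G Y` over a finite field:
# `|H| · Tr(Φ ρ(g) | T_ℓ X) = Σ_{x, x⁻¹gx ∈ H} Tr(φ α(x⁻¹gx) | T_ℓ Y)` for a diagonal `G`-endomorphism `Φ = ⊕ φ`,
# `Tr(π^m | T_ℓ B_G(Ind_H^G Y)) = Tr(π^m | T_ℓ B_H(Y))` and `|H| · Tr(π^m | T_ℓ B_W(Ind_H^G Y)) = Σ_{h ∈ H} c_W(h) Tr(α(h) π_Y^m | T_ℓ Y)`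

`X = ⊕_{t ∈ T} Y_t = Ind_H^G (Y, α)` is an induced action on a power of an abelian variety over a field `K` (bicone `b`,
`Σ_t π_t ≫ ι_t = 𝟙`; `ρ : G → End X` with `ι_t ρ(g) π_u = 0` for `u ≠ g t`; `T` transitive, `H = Stab(t₀)`,
`α(h) = ι_{t₀} ρ(h) π_{t₀}`; `Motives/AbelianVarietyInducedAction`).  Serre's Theorem 12 and Frobenius reciprocity
(`Motives/AbelianVarietyInducedAction`, §§2–3) are extended from `ρ(g)` to `Φ ≫ ρ(g)` for an endomorphism `Φ` of `X` which is
DIAGONAL, `ι_t ≫ Φ = φ ≫ ι_t` for an endomorphism `φ` of `Y` (`hΦ`), and `G`-EQUIVARIANT, `Φ ρ(g) = ρ(g) Φ` (`hΦρ`) — over a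
finite field the Frobenius `Φ = π_X^m`, `φ = π_Y^m` is such (`frobeniusHom_pow_comp`), and the twisted traces
`τ_m(g) = Tr(T_ℓ ρ(g) ∘ T_ℓ(π_X)^m)` are those through which `Motives/AbelianVarietyFactorFrobeniusTraces` expresses the
Frobenius of the factors `B_H`, `B_W`.  Theorems only, no definition:

* §1 diagonal endomorphisms: `Φ ≫ π_u = π_u ≫ φ`, `φ` commutes with the transfer maps `ι_t ρ(x) π_u`, the twisted trace
  **`Tr(Φ ρ(g) | T_ℓ X) = Σ_{t ∈ T^g} Tr(φ ≫ ι_t ρ(g) π_t | T_ℓ Y)`** and the conjugation rule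
  `Tr(φ ≫ ι_{xt} ρ(g) π_{xt}) = Tr(φ ≫ ι_t ρ(x⁻¹gx) π_t)` for `g` fixing `x t`;
* §2 **THE TWISTED THEOREM 12: `|H| · Tr(Φ ρ(g) | T_ℓ X) = Σ_{x ∈ G, (x⁻¹gx) t₀ = t₀} Tr(φ ≫ ι_{t₀} ρ(x⁻¹gx) π_{t₀} | T_ℓ Y)`**
  (`= Ind_H^G (h ↦ Tr(φ α(h)))(g) · |H|`) and the twisted Frobenius reciprocity against a class function `c`:
  **`|H| · Σ_g c(g) Tr(Φ ρ(g)) = |G| · Σ_{h ∈ H} c(h) Tr(φ α(h))`**;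
* §3 FINITE FIELD `K = 𝔽_q`, `ℓ ∤ q` — THE ARTIN FORMALISM FOR INDUCED ACTIONS: **`|H| · τ_m^X(g) = Σ_{x, (x⁻¹gx) t₀ = t₀} τ_m^Y-block(x⁻¹gx)`**
  (the twisted Frobenius traces of `Ind_H^G Y` are induced from those of `Y`: "`L(s, Ind_H^G χ) = L(s, χ)`" at the level of
  `ℓ`-adic traces), **`Tr(T_ℓ(π_{B_G(X)})^m) = Tr(T_ℓ(π_{B_H(Y)})^m)`** for all `m` (the fixed parts `B_G(Ind_H^G Y) = Im Σ_g ρ(g)`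
  and `B_H(Y) = Im Σ_h α(h)` have the same Frobenius traces — the same zeta function), and for every `W ∈ Irr_ℚ(G)`
  **`|H| · Tr(T_ℓ(π_{B_W(X)})^m) = Σ_{h ∈ H} c_W(h) · Tr(T_ℓ α(h) ∘ T_ℓ(π_Y)^m)`** (the Frobenius of the `W`-isotypical factor of
  an induced variety from the `H`-twisted Frobenius traces of `Y` — for a `G`-cover of curves `C → C/G` with `J_C ⊇ Ind`-pieces,
  the classical computation of `Z(C/H, t)` and of the Prym pieces from twisted point counts).

Scope (stated, not hidden): identities in `ℤ_ℓ`; no Lefschetz fixed-point formula, no point counts and no `ℓ`-independence are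
claimed; `B_G`, `B_H`, `B_W = Im u_W` (`u_W = Σ_g c_W(g) ρ(g)`, `|G| e_W = Σ_g c_W(g) g`) as in the prequels.

## References

* [SerreLinearRepresentations1977] J.-P. Serre, *Linear Representations of Finite Groups*, GTM 42 (1977): §3.3 Thm. 12, §7.2
  Thm. 13 and Remark (1).  Held: `book:serre1977-linear-representations-finite-groups`, PDF pp. 30–31, 50–53 read 2026-08-28.
* [Milne1986AbelianVarieties] J. S. Milne, *Abelian varieties*, in Cornell–Silverman (1986), §19, proof of Thm. 19.1
  (pp. 144–145: `π` commutes with all maps), §12 Prop. 12.9.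
* [DokchitserEtAl2022] V. Dokchitser, H. Green, A. Konstantinou, A. Morgan, *Parity of ranks of Jacobians of curves*,
  arXiv:2211.06357, §3 (additive functor lemma) and proof of Thm. 8.4 (`H¹_ℓ(X)^H ≃ H¹_ℓ(X/H)` as Galois modules).
* [LangeRodriguez2022] H. Lange, R. E. Rodríguez, *Decomposition of Jacobians by Prym Varieties*, LNM 2310 (2022), §2.9.1
  Prop. 2.9.3 (PDF p. 46), §3.5.
* [KaniRosen1989] E. Kani, M. Rosen, *Idempotent relations and factors of Jacobians*, Math. Ann. 284 (1989), §3 Thm. B, Thm. 3.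
* [MumfordAV1970] D. Mumford, *Abelian Varieties* (1970), §19 Thm. 1 (p. 173), Thm. 3 (p. 176), Thm. 4 (p. 180).
-/

noncomputable section

open CategoryTheory CategoryTheory.Limits MulAction
open Literature.NumberTheory.DiophantineGeometry
open Literature.RepresentationTheory.FiniteGroups

universe u

namespace Literature.AlgebraicGeometry.Motives

namespace AbelianVariety

namespace Imprimitive

variable {K : Type u} [Field K]

/-! ## §1 Diagonal equivariant endomorphisms `Φ = ⊕_t φ` and the twisted trace `Tr(Φ ρ(g)) = Σ_{t ∈ T^g} Tr(φ ι_t ρ(g) π_t)` -/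

section Diagonal

variable (ℓ : ℕ) [Fact ℓ.Prime] {Y : AbelianVariety K} {T : Type} [Fintype T] (b : Bicone (fun _ : T ↦ Y))
  {G : Type} [Group G] [MulAction G T] (ρ : G →* End b.pt) {Φ : b.pt ⟶ b.pt} {φ : Y ⟶ Y}

omit [MulAction G T] in
/-- A diagonal endomorphism `Φ = ⊕_t φ` (`ι_t ≫ Φ = φ ≫ ι_t` for all `t`) satisfies `Φ ≫ π_u = π_u ≫ φ`
(`Φ = Σ_t π_t ι_t Φ = Σ_t π_t φ ι_t`). [cite: MumfordAV1970, §19 Thm. 1 (p. 173)] -/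
theorem comp_π_eq_π_comp_of_diagonal (hb : ∑ t, b.π t ≫ b.ι t = 𝟙 b.pt) (hΦ : ∀ t, b.ι t ≫ Φ = φ ≫ b.ι t) (u : T) :
    Φ ≫ b.π u = b.π u ≫ φ := by
  classical
  calc Φ ≫ b.π u = ((∑ t, b.π t ≫ b.ι t) ≫ Φ) ≫ b.π u := by rw [hb, Category.id_comp]
    _ = ∑ t, b.π t ≫ (b.ι t ≫ Φ) ≫ b.π u := by
        rw [Preadditive.sum_comp, Preadditive.sum_comp]
        exact Finset.sum_congr rfl fun t _ ↦ by simp only [Category.assoc]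
    _ = ∑ t, b.π t ≫ φ ≫ b.ι t ≫ b.π u := Finset.sum_congr rfl fun t _ ↦ by rw [hΦ t, Category.assoc]
    _ = b.π u ≫ φ := by
        rw [Finset.sum_eq_single u (fun t _ ht ↦ by rw [bicone_ι_π_ne b ht, comp_zero, comp_zero])
          (fun h ↦ absurd (Finset.mem_univ _) h), bicone_ι_π_self]
        exact (Category.assoc _ _ _).symm.trans (Category.comp_id _)

omit [MulAction G T] in
/-- A diagonal `G`-endomorphism commutes with the blocks: `φ ≫ (ι_t ρ(x) π_u) = (ι_t ρ(x) π_u) ≫ φ` (in particular with the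
transfer maps `φ_{x,t}` and with the stabiliser action `α`). [cite: SerreLinearRepresentations1977, §3.3 Definition] [cite: MumfordAV1970, §19 Thm. 1 (p. 173)] -/
theorem comp_block_eq_block_comp_of_diagonal (hb : ∑ t, b.π t ≫ b.ι t = 𝟙 b.pt) (hΦ : ∀ t, b.ι t ≫ Φ = φ ≫ b.ι t)
    (hΦρ : ∀ g : G, Φ ≫ End.asHom (ρ g) = End.asHom (ρ g) ≫ Φ) (x : G) (t u : T) :
    φ ≫ (b.ι t ≫ End.asHom (ρ x) ≫ b.π u) = (b.ι t ≫ End.asHom (ρ x) ≫ b.π u) ≫ φ := by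
  rw [← Category.assoc, ← hΦ t, Category.assoc, ← Category.assoc Φ, hΦρ x, Category.assoc,
    comp_π_eq_π_comp_of_diagonal b hb hΦ u]
  simp only [Category.assoc]

/-- **The twisted trace: `Tr(Φ ρ(g) | T_ℓ X) = Σ_{t ∈ T^g} Tr(φ ≫ ι_t ρ(g) π_t | T_ℓ Y)`** for a diagonal `Φ = ⊕ φ` and an
action permuting the summands (`ℓ` invertible in `K`): the diagonal block of `Φ ρ(g)` at `t` is `φ ≫ ι_t ρ(g) π_t`, zero
unless `g t = t`. [cite: SerreLinearRepresentations1977, §3.3 Thm. 12 (proof)] [cite: MumfordAV1970, §19 Thm. 4 (p. 180)] -/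
theorem trace_tateModuleMap_comp_asHom_eq_sum_filter [DecidableEq T] (hb : ∑ t, b.π t ≫ b.ι t = 𝟙 b.pt)
    (hρ : ∀ (g : G) (t u : T), g • t ≠ u → b.ι t ≫ End.asHom (ρ g) ≫ b.π u = 0)
    (hΦ : ∀ t, b.ι t ≫ Φ = φ ≫ b.ι t) (hℓ : (ℓ : K) ≠ 0) (g : G) :
    LinearMap.trace ℤ_[ℓ] (b.pt.tateModule ℓ) (tateModuleMap ℓ (Φ ≫ End.asHom (ρ g))) =
      ∑ t ∈ Finset.univ.filter (fun t ↦ g • t = t),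
        LinearMap.trace ℤ_[ℓ] (Y.tateModule ℓ) (tateModuleMap ℓ (φ ≫ b.ι t ≫ End.asHom (ρ g) ≫ b.π t)) := by
  rw [trace_tateModuleMap_permPower_eq_sum ℓ b hb hℓ, Finset.sum_filter]
  refine Finset.sum_congr rfl fun t _ ↦ ?_
  have e : b.ι t ≫ (Φ ≫ End.asHom (ρ g)) ≫ b.π t = φ ≫ b.ι t ≫ End.asHom (ρ g) ≫ b.π t := by
    rw [← Category.assoc, ← Category.assoc, hΦ t]; simp only [Category.assoc]
  rw [e]
  split_ifs with h
  · rfl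
  · rw [hρ g t t h, comp_zero, tateModuleMap_zero, map_zero]

/-- **Twisted conjugation rule**: if `g` fixes `x t`, then `Tr(φ ≫ ι_{xt} ρ(g) π_{xt} | T_ℓ Y) = Tr(φ ≫ ι_t ρ(x⁻¹gx) π_t | T_ℓ Y)`
for a diagonal `G`-endomorphism `Φ = ⊕ φ` (the two blocks are conjugate by the transfer isomorphism `φ_{x,t}`, which commutes
with `φ`). [cite: SerreLinearRepresentations1977, §3.3 Thm. 12 (proof)] -/
theorem trace_tateModuleMap_comp_transfer_smul_eq (hb : ∑ t, b.π t ≫ b.ι t = 𝟙 b.pt)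
    (hρ : ∀ (g : G) (t u : T), g • t ≠ u → b.ι t ≫ End.asHom (ρ g) ≫ b.π u = 0)
    (hΦ : ∀ t, b.ι t ≫ Φ = φ ≫ b.ι t) (hΦρ : ∀ g : G, Φ ≫ End.asHom (ρ g) = End.asHom (ρ g) ≫ Φ) (hℓ : (ℓ : K) ≠ 0)
    {g x : G} {t : T} (hx : g • x • t = x • t) :
    LinearMap.trace ℤ_[ℓ] (Y.tateModule ℓ) (tateModuleMap ℓ (φ ≫ b.ι (x • t) ≫ End.asHom (ρ g) ≫ b.π (x • t))) =
      LinearMap.trace ℤ_[ℓ] (Y.tateModule ℓ) (tateModuleMap ℓ (φ ≫ b.ι t ≫ End.asHom (ρ (x⁻¹ * g * x)) ≫ b.π t)) := by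
  haveI := Y.module_free_tateModule_holds ℓ hℓ
  haveI := module_finite_tateModule_of_cast_ne_zero Y ℓ hℓ
  have h1 := ι_comp_asHom_eq b ρ hb hρ x t
  have h2 := ι_comp_asHom_eq b ρ hb hρ g (x • t)
  rw [hx] at h2
  have key : b.ι t ≫ End.asHom (ρ (x⁻¹ * g * x)) ≫ b.π t =
      (b.ι t ≫ End.asHom (ρ x) ≫ b.π (x • t)) ≫ (b.ι (x • t) ≫ End.asHom (ρ g) ≫ b.π (x • t)) ≫
        (b.ι (x • t) ≫ End.asHom (ρ x⁻¹) ≫ b.π t) := by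
    rw [asHom_map_mul_eq_comp, asHom_map_mul_eq_comp]
    simp only [Category.assoc]
    rw [reassoc_of% h1, reassoc_of% h2]
  have hc := comp_block_eq_block_comp_of_diagonal b ρ hb hΦ hΦρ x t (x • t)
  rw [key]
  conv_rhs =>
    rw [← Category.assoc, hc, Category.assoc, tateModuleMap_comp, LinearMap.trace_comp_comm', ← tateModuleMap_comp,
      Category.assoc, Category.assoc, transfer_inv_comp_transfer b ρ hb hρ x t]
  erw [Category.comp_id]

end Diagonal

/-! ## §2 The twisted Theorem 12 and twisted Frobenius reciprocity -/

section Twisted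

variable (ℓ : ℕ) [Fact ℓ.Prime] {Y : AbelianVariety K} {T : Type} [Fintype T] (b : Bicone (fun _ : T ↦ Y))
  {G : Type} [Group G] [Fintype G] [MulAction G T] [IsPretransitive G T] (ρ : G →* End b.pt) (t₀ : T)
  {Φ : b.pt ⟶ b.pt} {φ : Y ⟶ Y}

omit [Fintype T] in
/-- For a transitive action, `x ↦ x t₀` is `|Stab(t₀)|`-to-one onto `T`: `Σ_{x ∈ G} F(x t₀) = |Stab(t₀)| · Σ_{t ∈ T} F(t)`
(private helper). [folklore] -/
private theorem sum_apply_smul_eq_card_stabilizer_smul' [Fintype T] {M : Type*} [AddCommMonoid M] (F : T → M) :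
    ∑ x : G, F (x • t₀) = Nat.card (stabilizer G t₀) • ∑ t : T, F t := by
  classical
  have hfib : ∀ t : T, (Finset.univ.filter fun x : G ↦ x • t₀ = t).card = Nat.card (stabilizer G t₀) := by
    intro t
    obtain ⟨x₀, hx₀⟩ := exists_smul_eq G t₀ t
    have e : {x : G // x • t₀ = t} ≃ stabilizer G t₀ :=
      { toFun := fun x ↦ ⟨x₀⁻¹ * x.1, by rw [mem_stabilizer_iff, mul_smul, x.2, ← hx₀, inv_smul_smul]⟩
        invFun := fun h ↦ ⟨x₀ * (h : G), by rw [mul_smul, mem_stabilizer_iff.mp h.2, hx₀]⟩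
        left_inv := fun x ↦ Subtype.ext (mul_inv_cancel_left x₀ x.1)
        right_inv := fun h ↦ Subtype.ext (inv_mul_cancel_left x₀ (h : G)) }
    rw [← Nat.card_congr e, Nat.card_eq_fintype_card, Fintype.card_subtype]
  rw [← Finset.sum_fiberwise Finset.univ (fun x : G ↦ x • t₀) (fun x ↦ F (x • t₀)), Finset.smul_sum]
  refine Finset.sum_congr rfl fun t _ ↦ ?_
  rw [Finset.sum_congr rfl (fun x hx ↦ by rw [(Finset.mem_filter.mp hx).2] :
      ∀ x ∈ Finset.univ.filter (fun x : G ↦ x • t₀ = t), F (x • t₀) = F t), Finset.sum_const, hfib t]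

/-- **The twisted Theorem 12**: for a diagonal `G`-endomorphism `Φ = ⊕ φ` of `X = Ind_H^G Y` (`T` transitive, `H = Stab(t₀)`,
`ℓ` invertible in `K`), **`|H| · Tr(Φ ρ(g) | T_ℓ X) = Σ_{x ∈ G, (x⁻¹gx) t₀ = t₀} Tr(φ ≫ ι_{t₀} ρ(x⁻¹gx) π_{t₀} | T_ℓ Y)`** —
the twisted character `g ↦ Tr(Φ ρ(g))` is induced from `h ↦ Tr(φ α(h))`. [cite: SerreLinearRepresentations1977, §3.3 Thm. 12]
[cite: MumfordAV1970, §19 Thm. 4 (p. 180)] -/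
theorem card_stabilizer_mul_trace_tateModuleMap_comp_asHom_eq_sum [DecidableEq T] (hb : ∑ t, b.π t ≫ b.ι t = 𝟙 b.pt)
    (hρ : ∀ (g : G) (t u : T), g • t ≠ u → b.ι t ≫ End.asHom (ρ g) ≫ b.π u = 0)
    (hΦ : ∀ t, b.ι t ≫ Φ = φ ≫ b.ι t) (hΦρ : ∀ g : G, Φ ≫ End.asHom (ρ g) = End.asHom (ρ g) ≫ Φ) (hℓ : (ℓ : K) ≠ 0)
    (g : G) :
    (Nat.card (stabilizer G t₀) : ℤ_[ℓ]) *
        LinearMap.trace ℤ_[ℓ] (b.pt.tateModule ℓ) (tateModuleMap ℓ (Φ ≫ End.asHom (ρ g))) =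
      ∑ x : G, (if (x⁻¹ * g * x) • t₀ = t₀ then
        LinearMap.trace ℤ_[ℓ] (Y.tateModule ℓ) (tateModuleMap ℓ (φ ≫ b.ι t₀ ≫ End.asHom (ρ (x⁻¹ * g * x)) ≫ b.π t₀))
        else 0) := by
  set F : T → ℤ_[ℓ] := fun t ↦ if g • t = t then
    LinearMap.trace ℤ_[ℓ] (Y.tateModule ℓ) (tateModuleMap ℓ (φ ≫ b.ι t ≫ End.asHom (ρ g) ≫ b.π t)) else 0 with hF
  have hcond : ∀ x : G, (x⁻¹ * g * x) • t₀ = t₀ ↔ g • x • t₀ = x • t₀ := fun x ↦ by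
    rw [mul_smul, mul_smul, inv_smul_eq_iff]
  have hFx : ∀ x : G, (if (x⁻¹ * g * x) • t₀ = t₀ then
      LinearMap.trace ℤ_[ℓ] (Y.tateModule ℓ) (tateModuleMap ℓ (φ ≫ b.ι t₀ ≫ End.asHom (ρ (x⁻¹ * g * x)) ≫ b.π t₀))
      else 0) = F (x • t₀) := by
    intro x
    by_cases h : g • x • t₀ = x • t₀
    · rw [if_pos ((hcond x).2 h)]
      simp only [hF, h, ↓reduceIte]
      exact (trace_tateModuleMap_comp_transfer_smul_eq ℓ b ρ hb hρ hΦ hΦρ hℓ h).symm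
    · rw [if_neg (fun h' ↦ h ((hcond x).1 h'))]
      simp only [hF, h, ↓reduceIte]
  rw [Finset.sum_congr rfl fun x _ ↦ hFx x, sum_apply_smul_eq_card_stabilizer_smul' t₀ F, nsmul_eq_mul,
    trace_tateModuleMap_comp_asHom_eq_sum_filter ℓ b ρ hb hρ hΦ hℓ g, Finset.sum_filter]

variable [Fintype (stabilizer G t₀)] (α : stabilizer G t₀ →* End Y)

/-- **Twisted Frobenius reciprocity against a class function**: for `c : G → ℤ_ℓ` constant on conjugacy classes and a
diagonal `G`-endomorphism `Φ = ⊕ φ`, **`|H| · Σ_{g ∈ G} c(g) Tr(Φ ρ(g) | T_ℓ X) = |G| · Σ_{h ∈ H} c(h) Tr(φ α(h) | T_ℓ Y)`**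
(`⟨c, Ind_H^G ψ⟩_G = ⟨Res c, ψ⟩_H` for the twisted character `ψ(h) = Tr(φ α(h))`).
[cite: SerreLinearRepresentations1977, §7.2 Thm. 13 and Remark (1)] [cite: SerreLinearRepresentations1977, §3.3 Thm. 12] -/
theorem card_stabilizer_mul_sum_mul_trace_comp_eq (hb : ∑ t, b.π t ≫ b.ι t = 𝟙 b.pt)
    (hρ : ∀ (g : G) (t u : T), g • t ≠ u → b.ι t ≫ End.asHom (ρ g) ≫ b.π u = 0)
    (hΦ : ∀ t, b.ι t ≫ Φ = φ ≫ b.ι t) (hΦρ : ∀ g : G, Φ ≫ End.asHom (ρ g) = End.asHom (ρ g) ≫ Φ) (hℓ : (ℓ : K) ≠ 0)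
    (hα : ∀ h : stabilizer G t₀, End.asHom (α h) = b.ι t₀ ≫ End.asHom (ρ h) ≫ b.π t₀)
    (c : G → ℤ_[ℓ]) (hc : ∀ g x : G, c (x⁻¹ * g * x) = c g) :
    (Fintype.card (stabilizer G t₀) : ℤ_[ℓ]) *
        ∑ g, c g * LinearMap.trace ℤ_[ℓ] (b.pt.tateModule ℓ) (tateModuleMap ℓ (Φ ≫ End.asHom (ρ g))) =
      (Fintype.card G : ℤ_[ℓ]) *
        ∑ h : stabilizer G t₀, c h * LinearMap.trace ℤ_[ℓ] (Y.tateModule ℓ) (tateModuleMap ℓ (φ ≫ End.asHom (α h))) := by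
  classical
  set F : G → ℤ_[ℓ] := fun k ↦ if k • t₀ = t₀ then
    c k * LinearMap.trace ℤ_[ℓ] (Y.tateModule ℓ) (tateModuleMap ℓ (φ ≫ b.ι t₀ ≫ End.asHom (ρ k) ≫ b.π t₀)) else 0 with hF
  have hR : ∑ h : stabilizer G t₀, c h * LinearMap.trace ℤ_[ℓ] (Y.tateModule ℓ) (tateModuleMap ℓ (φ ≫ End.asHom (α h))) =
      ∑ k, F k := by
    rw [hF, ← Finset.sum_filter, Finset.sum_subtype (Finset.univ.filter fun k : G ↦ k • t₀ = t₀)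
      (p := fun k ↦ k ∈ stabilizer G t₀) (fun k ↦ by simp [mem_stabilizer_iff])]
    exact Finset.sum_congr rfl fun h _ ↦ by rw [hα h]
  have hL : (Fintype.card (stabilizer G t₀) : ℤ_[ℓ]) *
      ∑ g, c g * LinearMap.trace ℤ_[ℓ] (b.pt.tateModule ℓ) (tateModuleMap ℓ (Φ ≫ End.asHom (ρ g))) =
      ∑ x : G, ∑ k, F k := by
    rw [Finset.mul_sum]
    have h1 : ∀ g : G, (Fintype.card (stabilizer G t₀) : ℤ_[ℓ]) *
        (c g * LinearMap.trace ℤ_[ℓ] (b.pt.tateModule ℓ) (tateModuleMap ℓ (Φ ≫ End.asHom (ρ g)))) =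
        ∑ x : G, F (x⁻¹ * g * x) := by
      intro g
      rw [mul_left_comm, ← Nat.card_eq_fintype_card,
        card_stabilizer_mul_trace_tateModuleMap_comp_asHom_eq_sum ℓ b ρ t₀ hb hρ hΦ hΦρ hℓ g, Finset.mul_sum]
      refine Finset.sum_congr rfl fun x _ ↦ ?_
      rw [hF]
      dsimp only
      rw [hc g x]
      split_ifs <;> simp
    rw [Finset.sum_congr rfl fun g _ ↦ h1 g, Finset.sum_comm]
    refine Finset.sum_congr rfl fun x _ ↦ ?_
    exact Fintype.sum_equiv (MulAut.conj x⁻¹).toEquiv _ _ fun g ↦ by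
      simp [mul_assoc]
  rw [hL, hR, Finset.sum_const, Finset.card_univ, nsmul_eq_mul]

/-- **`|H| · Σ_{g ∈ G} Tr(Φ ρ(g) | T_ℓ X) = |G| · Σ_{h ∈ H} Tr(φ α(h) | T_ℓ Y)`** (the class function `c = 1`: twisted traces
of the norms, `Φ N_G` against `φ N_H`). [cite: SerreLinearRepresentations1977, §7.2 Thm. 13] -/
theorem card_stabilizer_mul_sum_trace_comp_eq (hb : ∑ t, b.π t ≫ b.ι t = 𝟙 b.pt)
    (hρ : ∀ (g : G) (t u : T), g • t ≠ u → b.ι t ≫ End.asHom (ρ g) ≫ b.π u = 0)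
    (hΦ : ∀ t, b.ι t ≫ Φ = φ ≫ b.ι t) (hΦρ : ∀ g : G, Φ ≫ End.asHom (ρ g) = End.asHom (ρ g) ≫ Φ) (hℓ : (ℓ : K) ≠ 0)
    (hα : ∀ h : stabilizer G t₀, End.asHom (α h) = b.ι t₀ ≫ End.asHom (ρ h) ≫ b.π t₀) :
    (Fintype.card (stabilizer G t₀) : ℤ_[ℓ]) *
        ∑ g, LinearMap.trace ℤ_[ℓ] (b.pt.tateModule ℓ) (tateModuleMap ℓ (Φ ≫ End.asHom (ρ g))) =
      (Fintype.card G : ℤ_[ℓ]) *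
        ∑ h : stabilizer G t₀, LinearMap.trace ℤ_[ℓ] (Y.tateModule ℓ) (tateModuleMap ℓ (φ ≫ End.asHom (α h))) := by
  have h := card_stabilizer_mul_sum_mul_trace_comp_eq ℓ b ρ t₀ α hb hρ hΦ hΦρ hℓ hα (fun _ ↦ 1) (fun _ _ ↦ rfl)
  simpa only [one_mul] using h

end Twisted

/-! ## §3 Finite field: the Artin formalism for `Ind_H^G Y` — twisted Frobenius traces, `B_G` and `B_W` -/

section Frobenius

variable [Finite K] (ℓ : ℕ) [Fact ℓ.Prime] {Y : AbelianVariety K} {T : Type} [Fintype T] (b : Bicone (fun _ : T ↦ Y))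
  {G : Type} [Group G] [Fintype G] [MulAction G T] [IsPretransitive G T] (ρ : G →* End b.pt) (t₀ : T)
  [Fintype (stabilizer G t₀)] (α : stabilizer G t₀ →* End Y)

/-- `T_ℓ(π_X^m ≫ f) = T_ℓ f ∘ T_ℓ(π_X)^m` (functoriality; the tree's `τ_m` convention). [cite: MumfordAV1970, §19 Thm. 3 (p. 176)] -/
private theorem tateModuleMap_frobeniusHom_pow_comp {X Z : AbelianVariety K} (f : X ⟶ Z) (m : ℕ) :
    tateModuleMap ℓ (((End.of (frobeniusHom X) ^ m : End X) : X ⟶ X) ≫ f) =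
      tateModuleMap ℓ f ∘ₗ tateModuleMap ℓ (frobeniusHom X) ^ m := by
  rw [tateModuleMap_comp, tateModuleMap_end_pow]

omit [Fintype (stabilizer G t₀)] in
/-- **The Artin formalism for induced actions, `ℓ`-adic form**: over a finite field `𝔽_q` with `ℓ ∤ q`, the twisted Frobenius
traces `τ_m^X(g) = Tr(T_ℓ ρ(g) ∘ T_ℓ(π_X)^m | T_ℓ X)` of `X = Ind_H^G Y` are INDUCED from those of `Y`:
**`|H| · τ_m^X(g) = Σ_{x ∈ G, (x⁻¹gx) t₀ = t₀} Tr(T_ℓ(ι_{t₀} ρ(x⁻¹gx) π_{t₀}) ∘ T_ℓ(π_Y)^m | T_ℓ Y)`** for every `m`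
(the twisted Theorem 12 for `Φ = π_X^m`, `φ = π_Y^m`, which is diagonal and central: `π` commutes with every homomorphism).
[cite: SerreLinearRepresentations1977, §3.3 Thm. 12] [cite: Milne1986AbelianVarieties, §19, proof of Thm. 19.1 (p. 144)]
[cite: DokchitserEtAl2022, proof of Thm. 8.4] -/
theorem card_stabilizer_mul_trace_frobeniusHom_pow_asHom_eq_sum [DecidableEq T] (hb : ∑ t, b.π t ≫ b.ι t = 𝟙 b.pt)
    (hρ : ∀ (g : G) (t u : T), g • t ≠ u → b.ι t ≫ End.asHom (ρ g) ≫ b.π u = 0) (hℓ : (ℓ : K) ≠ 0) (g : G) (m : ℕ) :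
    (Nat.card (stabilizer G t₀) : ℤ_[ℓ]) * LinearMap.trace ℤ_[ℓ] (b.pt.tateModule ℓ)
        (tateModuleMap ℓ (End.asHom (ρ g)) ∘ₗ tateModuleMap ℓ (frobeniusHom b.pt) ^ m) =
      ∑ x : G, (if (x⁻¹ * g * x) • t₀ = t₀ then LinearMap.trace ℤ_[ℓ] (Y.tateModule ℓ)
        (tateModuleMap ℓ (b.ι t₀ ≫ End.asHom (ρ (x⁻¹ * g * x)) ≫ b.π t₀) ∘ₗ tateModuleMap ℓ (frobeniusHom Y) ^ m)
        else 0) := by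
  have h := card_stabilizer_mul_trace_tateModuleMap_comp_asHom_eq_sum ℓ b ρ t₀ hb hρ
    (Φ := ((End.of (frobeniusHom b.pt) ^ m : End b.pt) : b.pt ⟶ b.pt))
    (φ := ((End.of (frobeniusHom Y) ^ m : End Y) : Y ⟶ Y))
    (fun t ↦ (frobeniusHom_pow_comp (b.ι t) m).symm) (fun g ↦ frobeniusHom_pow_comp (End.asHom (ρ g)) m) hℓ g
  rw [tateModuleMap_frobeniusHom_pow_comp] at h
  rw [h]
  refine Finset.sum_congr rfl fun x _ ↦ ?_
  split_ifs
  · rw [tateModuleMap_frobeniusHom_pow_comp]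
  · rfl

/-- **`B_G(Ind_H^G Y)` and `B_H(Y)` have the same Frobenius traces**: over a finite field `𝔽_q` with `ℓ ∤ q`,
**`Tr(T_ℓ(π_{B_G(X)})^m | T_ℓ B_G(X)) = Tr(T_ℓ(π_{B_H(Y)})^m | T_ℓ B_H(Y))`** for every `m`, where `B_G(X) = Im Σ_g ρ(g)`,
`B_H(Y) = Im Σ_{h ∈ H} α(h)` (`|G| Tr(π_{B_G}^m) = Σ_g τ_m^X(g)`, `|H| Tr(π_{B_H}^m) = Σ_h τ_m^Y(h)` and twisted Frobenius reciprocity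
against `1`) — the `ℓ`-adic content of "the zeta function of `C/H` is that of the `H`-fixed part": `L(s, Ind_H^G 1 ⊗ ·)`.
[cite: DokchitserEtAl2022, §3 and proof of Thm. 8.4 (`H¹_ℓ(X)^H ≃ H¹_ℓ(X/H)`)] [cite: SerreLinearRepresentations1977, §7.2 Thm. 13]
[cite: Milne1986AbelianVarieties, §19, proof of Thm. 19.1 (pp. 144–145)] -/
theorem trace_frobeniusHom_pow_image_normG_eq_of_induced (hb : ∑ t, b.π t ≫ b.ι t = 𝟙 b.pt)
    (hρ : ∀ (g : G) (t u : T), g • t ≠ u → b.ι t ≫ End.asHom (ρ g) ≫ b.π u = 0) (hℓ : (ℓ : K) ≠ 0)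
    (hα : ∀ h : stabilizer G t₀, End.asHom (α h) = b.ι t₀ ≫ End.asHom (ρ h) ≫ b.π t₀)
    {NG : b.pt ⟶ b.pt} (hNG : End.of NG = ∑ g, ρ g) {NH : Y ⟶ Y} (hNH : End.of NH = ∑ h : stabilizer G t₀, α h) (m : ℕ) :
    LinearMap.trace ℤ_[ℓ] ((image NG).tateModule ℓ) (tateModuleMap ℓ (frobeniusHom (image NG)) ^ m) =
      LinearMap.trace ℤ_[ℓ] ((image NH).tateModule ℓ) (tateModuleMap ℓ (frobeniusHom (image NH)) ^ m) := by
  have hG := trace_tateModuleMap_frobeniusHom_pow_comp_eq ℓ (normG_comp_normG_eq_card_nsmul ρ hNG) hℓ m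
  have hH := trace_tateModuleMap_frobeniusHom_pow_comp_eq ℓ (normG_comp_normG_eq_card_nsmul α hNH) hℓ m
  have hNG' : NG = ∑ g, End.asHom (ρ g) := hNG
  have hNH' : NH = ∑ h : stabilizer G t₀, End.asHom (α h) := hNH
  have hsG : LinearMap.trace ℤ_[ℓ] (b.pt.tateModule ℓ)
      (tateModuleMap ℓ (((End.of (frobeniusHom b.pt) ^ m : End b.pt) : b.pt ⟶ b.pt) ≫ NG)) =
      ∑ g, LinearMap.trace ℤ_[ℓ] (b.pt.tateModule ℓ)
        (tateModuleMap ℓ (((End.of (frobeniusHom b.pt) ^ m : End b.pt) : b.pt ⟶ b.pt) ≫ End.asHom (ρ g))) := by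
    conv_lhs => rw [hNG', Preadditive.comp_sum, tateModuleMap_sum, map_sum]
  have hsH : LinearMap.trace ℤ_[ℓ] (Y.tateModule ℓ)
      (tateModuleMap ℓ (((End.of (frobeniusHom Y) ^ m : End Y) : Y ⟶ Y) ≫ NH)) =
      ∑ h : stabilizer G t₀, LinearMap.trace ℤ_[ℓ] (Y.tateModule ℓ)
        (tateModuleMap ℓ (((End.of (frobeniusHom Y) ^ m : End Y) : Y ⟶ Y) ≫ End.asHom (α h))) := by
    conv_lhs => rw [hNH', Preadditive.comp_sum, tateModuleMap_sum, map_sum]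
  have hrec := card_stabilizer_mul_sum_trace_comp_eq ℓ b ρ t₀ α hb hρ
    (Φ := ((End.of (frobeniusHom b.pt) ^ m : End b.pt) : b.pt ⟶ b.pt))
    (φ := ((End.of (frobeniusHom Y) ^ m : End Y) : Y ⟶ Y))
    (fun t ↦ (frobeniusHom_pow_comp (b.ι t) m).symm) (fun g ↦ frobeniusHom_pow_comp (End.asHom (ρ g)) m) hℓ hα
  rw [← hsG, ← hsH, hG, hH, ← mul_assoc, ← mul_assoc,
    mul_comm (Fintype.card (stabilizer G t₀) : ℤ_[ℓ]) (Fintype.card G : ℤ_[ℓ])] at hrec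
  exact mul_left_cancel₀ (mul_ne_zero (Nat.cast_ne_zero.2 Fintype.card_ne_zero)
    (Nat.cast_ne_zero.2 Fintype.card_ne_zero)) hrec

variable {c : ratCharIdempotents G → G → ℤ}
  (hc : ∀ e : ratCharIdempotents G,
    (Fintype.card G : ℚ) • (e : MonoidAlgebra ℚ G) = ∑ g, (c e g : ℚ) • MonoidAlgebra.of ℚ G g)
  {u : ratCharIdempotents G → (b.pt ⟶ b.pt)} (hu : ∀ e, End.of (u e) = ∑ g, c e g • ρ g)

include hc hu in
/-- **The Frobenius of an isotypical factor of an induced variety from `H`-data**: over a finite field `𝔽_q` with `ℓ ∤ q`, for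
every `W ∈ Irr_ℚ(G)` with integral projector `u_W = Σ_g c_W(g) ρ(g)` (`|G| e_W = Σ_g c_W(g) g`), `B_W(X) = Im u_W`, and every `m`,
**`|H| · Tr(T_ℓ(π_{B_W(X)})^m | T_ℓ B_W(X)) = Σ_{h ∈ H} c_W(h) · Tr(T_ℓ α(h) ∘ T_ℓ(π_Y)^m | T_ℓ Y)`** — `|G| Tr(π_{B_W}^m) = Σ_g c_W(g) τ_m^X(g)`
(the tree's `card_mul_trace_frobeniusHom_pow_isotypical_eq_sum`) and twisted Frobenius reciprocity against the class function
`c_W`: the zeta function of the `W`-piece of `Ind_H^G Y` from the `H`-twisted Frobenius traces of `Y`.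
[cite: LangeRodriguez2022, §2.9.1 Prop. 2.9.3 (PDF p. 46) and §3.5] [cite: SerreLinearRepresentations1977, §7.2 Thm. 13]
[cite: DokchitserEtAl2022, §3 and proof of Thm. 8.4] [cite: Milne1986AbelianVarieties, §19, proof of Thm. 19.1 (pp. 144–145)] -/
theorem card_stabilizer_mul_trace_frobeniusHom_pow_isotypical_eq_sum_of_induced (hb : ∑ t, b.π t ≫ b.ι t = 𝟙 b.pt)
    (hρ : ∀ (g : G) (t u : T), g • t ≠ u → b.ι t ≫ End.asHom (ρ g) ≫ b.π u = 0) (hℓ : (ℓ : K) ≠ 0)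
    (hα : ∀ h : stabilizer G t₀, End.asHom (α h) = b.ι t₀ ≫ End.asHom (ρ h) ≫ b.π t₀) (e : ratCharIdempotents G)
    (m : ℕ) :
    (Fintype.card (stabilizer G t₀) : ℤ_[ℓ]) *
        LinearMap.trace ℤ_[ℓ] ((image (u e)).tateModule ℓ) (tateModuleMap ℓ (frobeniusHom (image (u e))) ^ m) =
      ∑ h : stabilizer G t₀, (c e h : ℤ_[ℓ]) * LinearMap.trace ℤ_[ℓ] (Y.tateModule ℓ)
        (tateModuleMap ℓ (End.asHom (α h)) ∘ₗ tateModuleMap ℓ (frobeniusHom Y) ^ m) := by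
  have h1 := card_mul_trace_frobeniusHom_pow_isotypical_eq_sum ℓ ρ hc hu hℓ e m
  have h2 := card_stabilizer_mul_sum_mul_trace_comp_eq ℓ b ρ t₀ α hb hρ
    (Φ := ((End.of (frobeniusHom b.pt) ^ m : End b.pt) : b.pt ⟶ b.pt))
    (φ := ((End.of (frobeniusHom Y) ^ m : End Y) : Y ⟶ Y))
    (fun t ↦ (frobeniusHom_pow_comp (b.ι t) m).symm) (fun g ↦ frobeniusHom_pow_comp (End.asHom (ρ g)) m) hℓ hα
    (fun g ↦ (c e g : ℤ_[ℓ])) (fun g x ↦ by rw [isotypicalCoeff_conj_eq hc e g x])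
  simp only [tateModuleMap_frobeniusHom_pow_comp] at h2
  rw [← h1, ← mul_assoc, mul_comm (Fintype.card (stabilizer G t₀) : ℤ_[ℓ]) (Fintype.card G : ℤ_[ℓ]), mul_assoc] at h2
  exact mul_left_cancel₀ (Nat.cast_ne_zero.2 Fintype.card_ne_zero) h2

end Frobenius

end Imprimitive

end AbelianVariety

end Literature.AlgebraicGeometry.Motives
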